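import Literature.Topology.FourManifolds.RebuildLowerArchFormulas
import Literature.Topology.FourManifolds.PlanarConvexFamily
import Literature.Topology.FourManifolds.KirbyMovesSlideEndInverse
import HarnessLib

/-!
# Reshaping the lower arch of the rebuilt attaching circle: the planar family

Topic `Literature/Topology/FourManifolds`; fact seat `provefact-IsStrictHandleSlide.isSurgery`
(R. C. Kirby, *The Topology of 4-Manifolds*, LNM 1374 (1989), Ch. I §4; remaining content: the
named fact (S) `Literature.Topology.FourManifolds.FramedLink.IsStrictHandleSlide.slideModel`).
The rebuilt attaching circle `K♮ = c.rebuild` of a band core `c` from `A` to `B = Kⱼ'`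
(`BandCoreRebuild.lean`) runs, for parameters `t ∈ [alo, tlo)`, along the band image of the
explicit lower arch `cLo t = (χ₁ t, v t)` (`RebuildLowerArchFormulas.lean`). This file shows
that **any admissible second lower track** `(X₁, H₁)` — smooth, agreeing with `cLo` off
`(alo + ε, tlo - ε/2)`, abscissa non-decreasing in `[0, 1]`, heights in `(1/10, 1/2)`, above `gLo`
where it lies on the right edge, injective and regular, co-monotone with `cLo` on common plateaux —
interpolates with `cLo` through a planar family in the band
(`BandData.planarFamily_convex`, `PlanarConvexFamily.lean`) for the knot `K♮`: hence `K♮` is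
ambient isotopic, with support in any neighbourhood of the band images of the tracks, to the knot
obtained by replacing the lower arch by the band image of `(X₁, H₁)`
(`PlanarFamily.isModification.exists_ambientIsotopy`, `PlanarBandFamily.lean`). The band images of
the intermediate tracks avoid the rest of `K♮` by the classification of its points
(`BandCore.kind_cases`, `pieceFun_typeA/B/O_lo/O_hi`). Proved here (no definitions, no named facts):

* `Literature.Topology.FourManifolds.BandCore.planarFamily_lowerTrack`.

## References

* R. C. Kirby, *The Topology of 4-Manifolds*, LNM 1374, Springer (1989), Ch. I §4. [Kirby1989]
* M. W. Hirsch, *Differential Topology* (1976), Ch. 8 §1, Thm. 1.3. [HirschDT1976]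
-/

open scoped Manifold ContDiff Topology Real
open Function Set Metric

noncomputable section

namespace Literature.Topology.FourManifolds

namespace BandCore

variable {A B : Knot} {avoid : Set (Metric.sphere (0 : EuclideanSpace ℝ (Fin 4)) 1)} (c : BandCore A B avoid)

/-- Heights of band points on the right edge determine the point: `band (1, h) = band (1, h')` with
`h, h' ∈ [1/10, 9/10]` forces `h = h'` (injectivity of the band on the square). [folklore] -/
theorem eq_of_band_pt2_one_eq {h h' : ℝ} (hh : h ∈ Icc (10⁻¹ : ℝ) (9 / 10)) (hh' : h' ∈ Icc (10⁻¹ : ℝ) (9 / 10))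
    (he : c.band (pt2 1 h) = c.band (pt2 1 h')) : h = h' := by
  have hδ := c.δ_pos
  have hm : ∀ {y : ℝ}, y ∈ Icc (10⁻¹ : ℝ) (9 / 10) → (pt2 1 y : EuclideanSpace ℝ (Fin 2)) ∈ squareNhd c.δ := by
    intro y hy i
    fin_cases i
    · show (1 : ℝ) ∈ Ioo (-c.δ) (1 + c.δ); constructor <;> linarith
    · show y ∈ Ioo (-c.δ) (1 + c.δ); constructor <;> linarith [hy.1, hy.2]
  have := c.injOn (hm hh) (hm hh') he
  exact congrArg (fun w : EuclideanSpace ℝ (Fin 2) ↦ w 1) this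

/-- Disjointness, type A parameters: a track point on the band which is a point of `A` lies on the
left edge, where the track is the lower arch itself. [folklore] -/
theorem false_of_typeA {x : EuclideanSpace ℝ (Fin 2)} (hxsq : x ∈ squareNhd c.δ)
    {s t : ℝ} (hs : s ∈ Icc (c.alo + c.epsLo / 2) (c.tlo - c.epsLo / 4)) (ht : t ∈ Ico c.alo (c.alo + 1))
    (hts : t ∉ Icc (c.alo + c.epsLo / 2) (c.tlo - c.epsLo / 4))
    (hA : t ≤ c.alo + c.epsLo ∨ c.ahi - c.epsHi ≤ t)
    (hleft : x 0 = 0 → s ≤ c.alo + c.epsLo ∧ x = c.cLo s)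
    (he : ((c.band x : Metric.sphere (0 : EuclideanSpace ℝ (Fin 4)) 1) : EuclideanSpace ℝ (Fin 4)) = c.pieceFun t) : False := by
  have hm := c.marks_lt
  have hε := c.epsLo_bounds.1
  have htlo1 : c.tlo < c.alo + 1 := by
    linarith [hm.2.2.2.1, hm.2.2.2.2.1, hm.2.2.2.2.2.1, hm.2.2.2.2.2.2.1, hm.2.2.2.2.2.2.2]
  rw [c.pieceFun_typeA ht hA, Knot.curve_apply] at he
  have hmem : c.band x ∈ range ⇑A := ⟨circlePt t, (Subtype.ext he).symm⟩
  have hx00 : x 0 = 0 := by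
    by_contra h; exact c.band_not_mem_range_A hxsq h hmem
  obtain ⟨hsle, hxeq⟩ := hleft hx00
  rw [hxeq, c.band_cLo_eq_A ⟨by linarith [hs.1, hm.2.1], hsle⟩] at he
  have hst : circlePt s = circlePt t := A.injective (Subtype.ext he)
  obtain ⟨n, hn⟩ := circlePt_eq_circlePt_iff.1 hst
  have hn1 : (n : ℝ) < 1 := by linarith [ht.1, hs.2]
  have hn2 : (-1 : ℝ) < n := by linarith [ht.2, hs.1]
  have hn1' : n < 1 := by exact_mod_cast hn1
  have hn2' : -1 < n := by exact_mod_cast hn2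
  obtain rfl : n = 0 := by omega
  simp only [Int.cast_zero, add_zero] at hn
  exact hts (hn ▸ hs)

/-- Disjointness, type B parameters: a track point on the band which is a point of `B` lies on the
right edge at a height `≥ gLo s`, which no parameter of the `B`-piece beyond `s` attains modulo the
period. [folklore] -/
theorem false_of_typeB {x : EuclideanSpace ℝ (Fin 2)} (hxsq : x ∈ squareNhd c.δ)
    (hx1I : x 1 ∈ Ioo (10⁻¹ : ℝ) 2⁻¹)
    {s t : ℝ} (hs : s ∈ Icc (c.alo + c.epsLo / 2) (c.tlo - c.epsLo / 4))
    (hts : t ∉ Icc (c.alo + c.epsLo / 2) (c.tlo - c.epsLo / 4))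
    (hB : t ∈ Icc (c.tlo - c.epsLo) (c.thi + c.epsHi))
    (hright : x 0 = 1 → c.tlo - 2 * c.epsLo ≤ s ∧ c.gLo s ≤ x 1)
    (he : ((c.band x : Metric.sphere (0 : EuclideanSpace ℝ (Fin 4)) 1) : EuclideanSpace ℝ (Fin 4)) = c.pieceFun t) : False := by
  have hm := c.marks_lt
  obtain ⟨hε, hε5, hεlam⟩ := c.epsLo_bounds
  obtain ⟨hε', hε'5, hε'lam⟩ := c.epsHi_bounds
  rw [c.pieceFun_typeB hB, Knot.curve_apply] at he
  have hmem : c.band x ∈ range ⇑B := ⟨circlePt (c.psi t), (Subtype.ext he).symm⟩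
  have hx01 : x 0 = 1 := by
    by_contra h; exact c.band_not_mem_range_B hxsq h hmem
  obtain ⟨hsge, hge⟩ := hright hx01
  -- `x = (1, h)`, `band x = B (circlePt (thetaB h))`
  have hh : x 1 ∈ Icc (10⁻¹ : ℝ) (9 / 10) := ⟨hx1I.1.le, by linarith [hx1I.2]⟩
  have hxeq : x = pt2 1 (x 1) := by
    ext i; fin_cases i
    · exact hx01
    · rfl
  rw [hxeq, ← c.apply_circlePt_thetaB hh] at he
  have hst : circlePt (c.thetaB (x 1)) = circlePt (c.psi t) := B.injective (Subtype.ext he)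
  obtain ⟨n, hn⟩ := circlePt_eq_circlePt_iff.1 hst
  -- `gLo s = heightB (psi s)`, `thetaB (gLo s) = psi s`
  have hanti := c.strictAntiOn_thetaB
  have hpsis : c.thetaB (3 / 10) ≤ c.psi s := by
    have h1 : c.psi (c.tlo - 2 * c.epsLo) ≤ c.psi s := c.strictMono_psi.monotone hsge
    have h2 : c.psi (c.tlo - 2 * c.epsLo) = c.thetaB (1 / 5) - 2 * c.epsLo * c.lam := by simp only [psi]; ring
    linarith
  have hpsis' : c.psi s ≤ c.thetaB (1 / 5) := by
    have h1 : c.psi s ≤ c.psi c.tlo := c.strictMono_psi.monotone (by linarith [hs.2])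
    rwa [c.psi_tlo] at h1
  have h73 : c.thetaB (7 / 20) < c.thetaB (3 / 10) := hanti (by norm_num) (by norm_num) (by norm_num)
  have h320 : c.thetaB (1 / 5) < c.thetaB (3 / 20) := hanti (by norm_num) (by norm_num) (by norm_num)
  have hsI' : s ∈ Icc (c.psiInv (c.thetaB (7 / 20))) (c.psiInv (c.thetaB (3 / 20))) := by
    constructor
    · have := c.strictMono_psiInv.monotone (h73.le.trans hpsis)
      rwa [c.psiInv_psi] at this
    · have := c.strictMono_psiInv.monotone (hpsis'.trans h320.le)
      rwa [c.psiInv_psi] at this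
  have hgLo : c.gLo s = c.heightB (c.psi s) := c.gLo_spec.2.1 s hsI'
  have hpsiI : c.psi s ∈ Icc (c.thetaB (9 / 10)) (c.thetaB 10⁻¹) := by
    have h1 : c.thetaB (9 / 10) ≤ c.thetaB (3 / 10) := hanti.antitoneOn (by norm_num) (by norm_num) (by norm_num)
    have h2 : c.thetaB (1 / 5) ≤ c.thetaB 10⁻¹ := hanti.antitoneOn (by norm_num) (by norm_num) (by norm_num)
    exact ⟨h1.trans hpsis, hpsis'.trans h2⟩
  have hθgLo : c.thetaB (c.gLo s) = c.psi s := by rw [hgLo]; exact (c.thetaB_heightB hpsiI).1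
  have hgI : c.gLo s ∈ Icc (10⁻¹ : ℝ) (9 / 10) := by
    have := c.gLo_mem (le_of_lt (lt_of_le_of_lt (by linarith [hs.2] : s ≤ c.tlo) c.tlo_marksB.1))
    exact ⟨this.1.le, by linarith [this.2]⟩
  -- lower bound: `thetaB h ≤ psi s < psi t`
  have hst' : s < t := by
    rcases lt_or_ge t s with h | h
    · exact absurd ⟨by linarith [hB.1], by linarith [hs.2]⟩ hts
    · exact lt_of_le_of_ne h (fun h' ↦ hts (h' ▸ hs))
  have hlow : c.thetaB (x 1) < c.psi t := by
    have h1 : c.thetaB (x 1) ≤ c.thetaB (c.gLo s) := hanti.antitoneOn hgI hh hge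
    have h2 : c.psi s < c.psi t := c.strictMono_psi hst'
    linarith
  -- upper bound: `psi t < thetaB h + 1`
  have hup : c.psi t < c.thetaB (x 1) + 1 := by
    have h1 : c.psi t ≤ c.psi (c.thi + c.epsHi) := c.strictMono_psi.monotone hB.2
    have h2 : c.psi (c.thi + c.epsHi) = c.thetaB (4 / 5) + 1 + c.epsHi * c.lam := by
      have := c.psi_thi; simp only [psi] at this ⊢; linarith
    have h3 : c.thetaB (7 / 10) ≤ c.thetaB (x 1) := hanti.antitoneOn hh (by norm_num) (by linarith [hx1I.2])
    have h4 : c.thetaB (4 / 5) < c.thetaB (7 / 10) := hanti (by norm_num) (by norm_num) (by norm_num)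
    have h5 : c.epsHi * c.lam ≤ (c.thetaB (7 / 10) - c.thetaB (4 / 5)) / 2 := by linarith
    linarith
  have hn1 : (n : ℝ) < 0 := by linarith
  have hn2 : (-1 : ℝ) < n := by linarith
  have hn1' : n < 0 := by exact_mod_cast hn1
  have hn2' : -1 < n := by exact_mod_cast hn2
  omega

/-- Disjointness, upper type O parameters: heights `> 3/5` versus `< 1/2`. [folklore] -/
theorem false_of_typeO_hi {x : EuclideanSpace ℝ (Fin 2)} (hxsq : x ∈ squareNhd c.δ) (hx1 : x 1 < 2⁻¹) {t : ℝ}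
    (hO : t ∈ Ioo (c.thi + c.epsHi) (c.ahi - c.epsHi))
    (he : ((c.band x : Metric.sphere (0 : EuclideanSpace ℝ (Fin 4)) 1) : EuclideanSpace ℝ (Fin 4)) = c.pieceFun t) : False := by
  obtain ⟨hpf, hsq, -, hhi, -, -⟩ := c.pieceFun_typeO_hi hO
  rw [hpf] at he
  have hxe : x = c.cUp t := c.injOn hxsq hsq (Subtype.ext he)
  have : x 1 = c.cUp t 1 := by rw [hxe]
  linarith

/-- **The planar family reshaping the lower arch.** See the module docstring; the parameters of
the family are `a = alo`, `ε_f = min (ε/2) (alo + 1 - tlo)`, `S = [alo + ε/2, tlo - ε/4]`, inner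
interval `(alo + ε, tlo - ε/2)`, `ε = epsLo`. [cite: HirschDT1976, Ch. 8 §1, Thm. 1.3] -/
theorem planarFamily_lowerTrack (hAB : Disjoint (range ⇑A) (range ⇑B)) {X₁ H₁ : ℝ → ℝ}
    (hX₁s : ContDiff ℝ ∞ X₁) (hH₁s : ContDiff ℝ ∞ H₁)
    (hagreeX : ∀ t, t ∉ Ioo (c.alo + c.epsLo) (c.tlo - c.epsLo / 2) → X₁ t = c.cLo t 0)
    (hagreeH : ∀ t, t ∉ Ioo (c.alo + c.epsLo) (c.tlo - c.epsLo / 2) → H₁ t = c.cLo t 1)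
    (hX₁I : ∀ t, X₁ t ∈ Icc (0 : ℝ) 1) (hdX₁ : ∀ t, 0 ≤ deriv X₁ t)
    (hX₁pos : ∀ t, c.alo + c.epsLo < t → 0 < X₁ t) (hX₁lt : ∀ t, t < c.tlo - 2 * c.epsLo → X₁ t < 1)
    (hH₁I : ∀ t ∈ Icc (c.alo + c.epsLo / 2) (c.tlo - c.epsLo / 4), H₁ t ∈ Ioo (10⁻¹ : ℝ) 2⁻¹)
    (hH₁ge : ∀ t ∈ Icc (c.tlo - 2 * c.epsLo) (c.tlo - c.epsLo / 4), X₁ t = 1 → c.gLo t ≤ H₁ t)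
    (hinj₁ : InjOn (fun t ↦ (pt2 (X₁ t) (H₁ t) : EuclideanSpace ℝ (Fin 2))) (Icc (c.alo + c.epsLo / 2) (c.tlo - c.epsLo / 4)))
    (hreg₁ : ∀ s ∈ Icc (c.alo + c.epsLo / 2) (c.tlo - c.epsLo / 4), deriv X₁ s = 0 → deriv H₁ s ≠ 0)
    (hco : ∀ t ∈ Icc (c.alo + c.epsLo / 2) (c.tlo - c.epsLo / 4), ∀ t' ∈ Icc (c.alo + c.epsLo / 2) (c.tlo - c.epsLo / 4),
      t < t' → c.cLo t 0 = c.cLo t' 0 → X₁ t = X₁ t' →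
      (c.cLo t 1 < c.cLo t' 1 ∧ H₁ t < H₁ t') ∨ (c.cLo t' 1 < c.cLo t 1 ∧ H₁ t' < H₁ t))
    (hcoD : ∀ s ∈ Icc (c.alo + c.epsLo / 2) (c.tlo - c.epsLo / 4),
      deriv (fun t ↦ c.cLo t 0) s = 0 → deriv X₁ s = 0 → 0 < deriv (fun t ↦ c.cLo t 1) s * deriv H₁ s) :
    (c.rebuildData hAB).PlanarFamily (c.rebuild hAB) c.alo (min (c.epsLo / 2) (c.alo + 1 - c.tlo))
      (c.alo + c.epsLo / 2) (c.alo + c.epsLo) (c.tlo - c.epsLo / 2) (c.tlo - c.epsLo / 4)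
      (fun u t ↦ pt2 ((1 - u) * c.cLo t 0 + u * X₁ t) ((1 - u) * c.cLo t 1 + u * H₁ t)) := by
  -- basic parameter facts
  have hm := c.marks_lt
  obtain ⟨hε, hε5, hεlam⟩ := c.epsLo_bounds
  have hat : c.alo + 2 * c.epsLo < c.tlo - 2 * c.epsLo := c.alo_add_lt_tlo_sub
  have htlo1 : c.tlo < c.alo + 1 := by
    linarith [hm.2.2.2.1, hm.2.2.2.2.1, hm.2.2.2.2.2.1, hm.2.2.2.2.2.2.1, hm.2.2.2.2.2.2.2]
  have hδ := c.δ_pos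
  set ε := c.epsLo with hεdef
  -- the first track `cLo` in coordinates
  have hX₀s : ContDiff ℝ ∞ (fun t ↦ c.cLo t 0) := by
    rw [show (fun t ↦ c.cLo t 0) = smoothStep (c.alo + ε) (c.tlo - ε) from funext fun t ↦ c.cLo_apply_zero t]
    exact contDiff_smoothStep _ _
  have hH₀s : ContDiff ℝ ∞ (fun t ↦ c.cLo t 1) := (contDiff_euclidean.1 c.cLo_spec.1) 1
  have hpt : ∀ t, (pt2 (c.cLo t 0) (c.cLo t 1) : EuclideanSpace ℝ (Fin 2)) = c.cLo t := fun t ↦ by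
    ext i; fin_cases i <;> rfl
  refine BandData.planarFamily_convex (c.rebuildData hAB) (lt_min (by linarith) (by linarith))
    ⟨by simp only [hεdef]; linarith [min_le_left (c.epsLo / 2) (c.alo + 1 - c.tlo)], by linarith, by linarith, by linarith,
      by linarith [min_le_right (c.epsLo / 2) (c.alo + 1 - c.tlo)]⟩
    hX₀s hX₁s hH₀s hH₁s hagreeX hagreeH (fun s hs ↦ ?_) (fun s hs ↦ ?_) (fun s hs ↦ ?_)
    (fun s _ ↦ c.deriv_cLo_fst_nonneg s) (fun s _ ↦ hdX₁ s) (fun t ht t' ht' he ↦ ?_) hinj₁ hco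
    (fun s _ h0 ↦ ?_) hreg₁ hcoD (fun u hu s hs t ht hts ↦ ?_)
  · -- curve_eq: on `S ⊆ [alo, tlo)` the knot is `band (cLo s)`
    rw [hpt, rebuildData_band]
    exact c.curve_rebuild_eq_band_cLo hAB ⟨by linarith [hs.1], by linarith [hs.2]⟩
  · -- mem₀
    rw [hpt, rebuildData_δ]
    exact (c.cLo_mem ⟨by linarith [hs.1], by linarith [hs.2]⟩).1
  · -- mem₁
    rw [rebuildData_δ]
    intro i
    fin_cases i
    · show X₁ s ∈ Ioo (-c.δ) (1 + c.δ)
      exact ⟨by linarith [(hX₁I s).1], by linarith [(hX₁I s).2]⟩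
    · show H₁ s ∈ Ioo (-c.δ) (1 + c.δ)
      have h := hH₁I s hs
      exact ⟨by linarith [h.1], by linarith [h.2]⟩
  · -- injectivity of the first track (from the global injectivity of `cLo`)
    have he' : c.cLo t = c.cLo t' := by simpa only [hpt] using he
    exact c.cLo_spec.2.2.2.2.2.2.1 he'
  · -- regularity of the first track: `deriv cLo s = (deriv X₀ s, deriv H₀ s) ≠ 0`
    intro h1
    apply c.cLo_spec.2.2.2.2.2.2.2 s
    have hX₀d : HasDerivAt (fun t ↦ c.cLo t 0) (deriv (fun t ↦ c.cLo t 0) s) s :=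
      ((hX₀s.differentiable (by simp)) s).hasDerivAt
    have hH₀d : HasDerivAt (fun t ↦ c.cLo t 1) (deriv (fun t ↦ c.cLo t 1) s) s :=
      ((hH₀s.differentiable (by simp)) s).hasDerivAt
    have hc := hasDerivAt_pt2 hX₀d hH₀d
    have hfun : (fun t ↦ (pt2 (c.cLo t 0) (c.cLo t 1) : EuclideanSpace ℝ (Fin 2))) = c.cLo := funext hpt
    rw [hfun] at hc
    rw [hc.deriv, h0, h1]
    ext i; fin_cases i <;> rfl
  · -- disjointness from the rest of `K♮`
    intro he
    set x : EuclideanSpace ℝ (Fin 2) := pt2 ((1 - u) * c.cLo s 0 + u * X₁ s) ((1 - u) * c.cLo s 1 + u * H₁ s) with hx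
    have hsI : s ∈ Icc c.alo c.tlo := ⟨by linarith [hs.1], by linarith [hs.2]⟩
    have hx0 : x 0 = (1 - u) * c.cLo s 0 + u * X₁ s := rfl
    have hx1 : x 1 = (1 - u) * c.cLo s 1 + u * H₁ s := rfl
    have hc0 := c.cLo_fst_mem_Icc s
    have hc1 : c.cLo s 1 ∈ Ioo (10⁻¹ : ℝ) (2 / 5) := (c.cLo_mem hsI).2
    have hX := hX₁I s
    have hH := hH₁I s hs
    have hx0I : x 0 ∈ Icc (0 : ℝ) 1 := by
      rw [hx0]
      have a1 := mul_nonneg hu.1 hX.1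
      have a2 := mul_nonneg (sub_nonneg.2 hu.2) hc0.1
      have a3 := mul_nonneg (sub_nonneg.2 hu.2) (sub_nonneg.2 hc0.2)
      have a4 := mul_nonneg hu.1 (sub_nonneg.2 hX.2)
      constructor <;> nlinarith
    have hx1I : x 1 ∈ Ioo (10⁻¹ : ℝ) 2⁻¹ := by
      rw [hx1]; exact convex_mem_Ioo ⟨hc1.1, by linarith [hc1.2]⟩ hH hu
    have hxsq : x ∈ squareNhd c.δ := by
      intro i; fin_cases i
      · show x 0 ∈ Ioo (-c.δ) (1 + c.δ); exact ⟨by linarith [hx0I.1], by linarith [hx0I.2]⟩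
      · show x 1 ∈ Ioo (-c.δ) (1 + c.δ); exact ⟨by linarith [hx1I.1], by linarith [hx1I.2]⟩
    rw [rebuildData_band] at he
    rw [c.curve_rebuild_eq_pieceFun hAB ht] at he
    rcases c.kind_cases t with hA | hB | hO | hO
    · refine c.false_of_typeA hxsq hs ht hts hA (fun hx00 ↦ ?_) he
      -- `x 0 = 0` forces `s ≤ alo + ε` and then `x = cLo s`
      have hsle : s ≤ c.alo + ε := by
        by_contra hlt; push Not at hlt
        have h1 : 0 < c.cLo s 0 := by
          rw [c.cLo_apply_zero]
          rcases lt_or_ge s (c.tlo - ε) with h | h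
          · exact (smoothStep_mem_Ioo (by linarith) ⟨hlt, h⟩).1
          · rw [smoothStep_of_ge (by linarith) h]; exact one_pos
        have h2 : 0 < X₁ s := hX₁pos s hlt
        have : 0 < x 0 := by
          rw [hx0]
          have ha : 0 ≤ (1 - u) * c.cLo s 0 := mul_nonneg (sub_nonneg.2 hu.2) h1.le
          have hb : 0 ≤ u * X₁ s := mul_nonneg hu.1 h2.le
          rcases hu.1.eq_or_lt with hu0 | hu0
          · rw [← hu0]; linarith
          · nlinarith
        linarith
      have hnot : s ∉ Ioo (c.alo + c.epsLo) (c.tlo - c.epsLo / 2) := fun h ↦ by linarith [h.1]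
      refine ⟨hsle, ?_⟩
      rw [← hpt s]
      ext i; fin_cases i
      · show (1 - u) * c.cLo s 0 + u * X₁ s = c.cLo s 0
        rw [hagreeX s hnot]; ring
      · show (1 - u) * c.cLo s 1 + u * H₁ s = c.cLo s 1
        rw [hagreeH s hnot]; ring
    · refine c.false_of_typeB hxsq hx1I hs hts hB (fun hx01 ↦ ?_) he
      -- `x 0 = 1` forces `s ≥ tlo - 2ε` and the height bound
      have hsge : c.tlo - 2 * ε ≤ s := by
        by_contra hlt; push Not at hlt
        have h1 : c.cLo s 0 < 1 := by
          rw [c.cLo_apply_zero]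
          rcases le_or_gt s (c.alo + ε) with h | h
          · rw [smoothStep_of_le (by linarith) h]; norm_num
          · exact (smoothStep_mem_Ioo (by linarith) ⟨h, by linarith⟩).2
        have h2 : X₁ s < 1 := hX₁lt s hlt
        have : x 0 < 1 := by
          rw [hx0]
          have ha : 0 ≤ (1 - u) * (1 - c.cLo s 0) := mul_nonneg (sub_nonneg.2 hu.2) (sub_nonneg.2 h1.le)
          have hb : 0 ≤ u * (1 - X₁ s) := mul_nonneg hu.1 (sub_nonneg.2 h2.le)
          rcases hu.1.eq_or_lt with hu0 | hu0
          · rw [← hu0]; linarith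
          · have : 0 < u * (1 - X₁ s) := mul_pos hu0 (sub_pos.2 h2); nlinarith
        linarith
      refine ⟨hsge, ?_⟩
      have hv : c.cLo s 1 = c.gLo s := c.cLo_snd_eq_gLo_of_ge hsge
      rcases hu.1.eq_or_lt with hu0 | hu0
      · rw [hx1, ← hu0, hv]; simp
      · have hX1 : X₁ s = 1 := by
          have h1 : c.cLo s 0 ≤ 1 := hc0.2
          have h2 : X₁ s ≤ 1 := hX.2
          rw [hx0] at hx01
          have ha : 0 ≤ (1 - u) * (1 - c.cLo s 0) := mul_nonneg (sub_nonneg.2 hu.2) (sub_nonneg.2 h1)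
          have hb : 0 ≤ u * (1 - X₁ s) := mul_nonneg hu.1 (sub_nonneg.2 h2)
          have hsum : (1 - u) * (1 - c.cLo s 0) + u * (1 - X₁ s) = 0 := by linarith
          have hb0 : u * (1 - X₁ s) = 0 := by linarith
          rcases mul_eq_zero.1 hb0 with h | h
          · exact absurd h hu0.ne'
          · linarith
        have hH1 := hH₁ge s ⟨hsge, hs.2⟩ hX1
        have hpos : 0 ≤ u * (H₁ s - c.gLo s) := mul_nonneg hu.1 (sub_nonneg.2 hH1)
        rw [hx1, hv]; linarith
    · -- type O (lower arch): impossible, these parameters lie in `S`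
      exact hts ⟨by linarith [hO.1], by linarith [hO.2]⟩
    · exact c.false_of_typeO_hi hxsq hx1I.2 hO he

end BandCore

end Literature.Topology.FourManifolds
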